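import Mathlib
import HarnessLib
import Literature.MathematicalPhysics.QuantumLattice.KohnLuttinger
import Literature.MathematicalPhysics.QuantumLattice.KohnLuttingerPairingFormPolar
import Summits.HubbardSuperconductivity.HubbardSuperconductivity.Theorems.WeakCouplingBCSWcbcsKohnLuttingerB1gReduction

/-!
# Route `WeakCouplingBCS` — reductions of the remaining analytic leaves of a `t′` certificate cell to certifiable rows
# (located inputs of «(KLSCAN)-TPRIME-SOUNDNESS» — conjuncts 1, 3, 5 of p3's bundled hypothesis `KLTPAnalytic ε μ`;
# certificate half of stmt-HubbardSuperconductivity-0158; seat p4 g19)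

For a band `ε` and a level `μ` write `F = fermiCurve ε μ`, `σ = fermiCurveMeasure ε μ`.  After …TPrimeD4Invariant / …TPrimeLindhardD4 (the two
`D₄` leaves, theorems at every `t′`) and …TPrimeFiniteMeasure (`IsFiniteMeasure σ` from a speed floor and a finite length), the analytic facts a `t′` row of
the KL-MARGIN-SCAN needs are reduced here to rows an interval engine certifies plus ONE analytic leaf (finite length), by generic lemmas:

* §1 **`klph_memLp_kernel_of_bound`** — the Hilbert–Schmidt leaf: if `σ` is finite and `|χ₀[ε](k + k′)| ≤ C` for all `k, k′ ∈ F` (a certified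
  SUP BOUND of the Lindhard function over `F + F`), then `(k, k′) ↦ χ₀(k + k′)` is in `L²(σ ⊗ σ)`.
* §2 **`klph_channelStates_nonempty_of_pos`** — the existence leaf: a channel `χ` has a state as soon as ONE `L²(σ)` function in the channel has
  `0 < ∫ φ² dσ` (a certified positive Ritz denominator) — Literature `isChannelState_normalize`.
* §3 **`klph_hausdorffMeasure_le_of_lipschitz_cover`** — the length leaf's interface: a set covered by finitely many images of real intervals under
  Lipschitz maps has `μH[1] ≤ Σ Kᵢ · |Iᵢ| < ∞` (`LipschitzOnWith.hausdorffMeasure_image_le`, `μH[1] = volume` on `ℝ`); the cover of the `t′` Fermi curve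
  by such arcs (`y = ±arccos((−μ/2 − cos x)/(1 + 2t′cos x))` and its mirror, on intervals with a slope bound) is the analytic leaf «HausdorffFinite-tp»,
  NOT done here.

Generic in `ε`; no definitions; nothing asserts a margin, a window or superconductivity.
References: S. Raghu, S. A. Kivelson, D. J. Scalapino, Phys. Rev. B 81 (2010) 224505, §II (5)–(8), §III (17).
-/

noncomputable section

-- the tree's namespace `Summit.<Summit>.<Problem>.Theorems` repeats the summit name by design (D-0017)
set_option linter.dupNamespace false

namespace Summit.HubbardSuperconductivity.HubbardSuperconductivity.Theorems

open MeasureTheory Set Real Literature.MathematicalPhysics.QuantumLattice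
open scoped ENNReal NNReal

/-! ### §1 The Hilbert–Schmidt leaf from a sup bound -/

/-- **`χ₀(k + k′) ∈ L²(σ ⊗ σ)` from a sup bound on `F × F` and finiteness of `σ`.** [cite: RaghuKivelsonScalapino2010, §II (7)] -/
theorem klph_memLp_kernel_of_bound {ε : Momentum → ℝ} (hε : Measurable ε) (μ : ℝ)
    [IsFiniteMeasure (fermiCurveMeasure ε μ)] {C : ℝ}
    (hC : ∀ k ∈ fermiCurve ε μ, ∀ k' ∈ fermiCurve ε μ, |lindhardFunction ε μ (k + k')| ≤ C) :
    MemLp (fun z : Momentum × Momentum => lindhardFunction ε μ (z.1 + z.2)) 2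
      ((fermiCurveMeasure ε μ).prod (fermiCurveMeasure ε μ)) := by
  have hmeas : AEStronglyMeasurable (fun z : Momentum × Momentum => lindhardFunction ε μ (z.1 + z.2))
      ((fermiCurveMeasure ε μ).prod (fermiCurveMeasure ε μ)) :=
    ((measurable_lindhardFunction hε μ).comp measurable_add).aestronglyMeasurable
  refine MemLp.of_bound hmeas C ?_
  -- `σ ⊗ σ` lives on `F × F`
  have hF0 : fermiCurveMeasure ε μ (fermiCurve ε μ)ᶜ = 0 :=
    measure_eq_zero_iff_ae_notMem.2 ((ae_mem_fermiCurve hε μ).mono fun k hk hk' => hk' hk)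
  have hnull : ((fermiCurveMeasure ε μ).prod (fermiCurveMeasure ε μ))
      (((fermiCurve ε μ)ᶜ ×ˢ (univ : Set Momentum)) ∪ ((univ : Set Momentum) ×ˢ (fermiCurve ε μ)ᶜ)) = 0 := by
    refine measure_union_null ?_ ?_
    · rw [Measure.prod_prod, hF0, zero_mul]
    · rw [Measure.prod_prod, hF0, mul_zero]
  have hae : ∀ᵐ z ∂((fermiCurveMeasure ε μ).prod (fermiCurveMeasure ε μ)),
      z ∉ ((fermiCurve ε μ)ᶜ ×ˢ (univ : Set Momentum)) ∪ ((univ : Set Momentum) ×ˢ (fermiCurve ε μ)ᶜ) :=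
    measure_eq_zero_iff_ae_notMem.1 hnull
  filter_upwards [hae] with z hz
  simp only [mem_union, mem_prod, mem_compl_iff, mem_univ, and_true, true_and, not_or, not_not] at hz
  rw [Real.norm_eq_abs]
  exact hC z.1 hz.1 z.2 hz.2

/-! ### §2 The existence leaf from one positive square integral -/

/-- **A channel with one in-channel `L²(σ)` function of positive square integral has a channel state** (normalise it).
[cite: RaghuKivelsonScalapino2010, §III (17)] -/
theorem klph_channelStates_nonempty_of_pos {ε : Momentum → ℝ} {μ : ℝ} {χ : D4Irrep} {φ : Momentum → ℝ}
    (hmem : MemLp φ 2 (fermiCurveMeasure ε μ)) (hch : InChannel χ φ)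
    (hpos : 0 < ∫ k, φ k ^ 2 ∂fermiCurveMeasure ε μ) :
    {ψ | IsChannelState ε μ χ ψ}.Nonempty :=
  ⟨_, isChannelState_normalize hmem hch hpos⟩

/-- The same for a bounded measurable in-channel function on a finite Fermi-curve measure (e.g. a trigonometric trial polynomial of a record):
`0 < ∫ φ² dσ` alone gives a channel state. [cite: RaghuKivelsonScalapino2010, §III (17)] -/
theorem klph_channelStates_nonempty_of_bound_of_pos {ε : Momentum → ℝ} {μ : ℝ} [IsFiniteMeasure (fermiCurveMeasure ε μ)]
    {χ : D4Irrep} {φ : Momentum → ℝ} (hφm : AEStronglyMeasurable φ (fermiCurveMeasure ε μ)) {C : ℝ} (hφC : ∀ k, |φ k| ≤ C)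
    (hch : InChannel χ φ) (hpos : 0 < ∫ k, φ k ^ 2 ∂fermiCurveMeasure ε μ) :
    {ψ | IsChannelState ε μ χ ψ}.Nonempty :=
  klph_channelStates_nonempty_of_pos
    (MemLp.of_bound hφm C (Filter.Eventually.of_forall fun k => by rw [Real.norm_eq_abs]; exact hφC k)) hch hpos

/-! ### §3 The length leaf's interface: Lipschitz arc covers -/

/-- An arc `f '' [a, b]` of a `K`-Lipschitz map from an interval into momentum space has length `μH[1] ≤ K · (b − a)`. [folklore] -/
theorem klph_hausdorffMeasure_image_Icc_le {f : ℝ → Momentum} {K : ℝ≥0} {a b : ℝ} (hf : LipschitzOnWith K f (Icc a b)) :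
    μH[1] (f '' Icc a b) ≤ (K : ℝ≥0∞) * ENNReal.ofReal (b - a) := by
  have h := hf.hausdorffMeasure_image_le (d := 1) zero_le_one
  rw [ENNReal.rpow_one, hausdorffMeasure_real, Real.volume_Icc] at h
  exact h

/-- **Lipschitz arc covers bound the length**: if `S ⊆ ⋃_{i ∈ s} fᵢ '' [aᵢ, bᵢ]` with `fᵢ` `Kᵢ`-Lipschitz on `[aᵢ, bᵢ]`, then
`μH[1] S ≤ Σ_{i ∈ s} Kᵢ · (bᵢ − aᵢ)`, in particular `μH[1] S < ∞`.  (The interface of the finite-length leaf «HausdorffFinite-tp» of a `t′`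
Fermi curve: the arcs are the graphs `x ↦ (x, ±arccos g(x))`, `g(x) = (−μ/2 − cos x)/(1 + 2t′cos x)`, and their mirrors, on intervals with a slope bound.)
[folklore] -/
theorem klph_hausdorffMeasure_le_of_lipschitz_cover {ι : Type*} (s : Finset ι) {S : Set Momentum}
    (f : ι → ℝ → Momentum) (K : ι → ℝ≥0) (a b : ι → ℝ)
    (hf : ∀ i ∈ s, LipschitzOnWith (K i) (f i) (Icc (a i) (b i)))
    (hcover : S ⊆ ⋃ i ∈ s, f i '' Icc (a i) (b i)) :
    μH[1] S ≤ ∑ i ∈ s, (K i : ℝ≥0∞) * ENNReal.ofReal (b i - a i) := by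
  calc μH[1] S ≤ μH[1] (⋃ i ∈ s, f i '' Icc (a i) (b i)) := measure_mono hcover
    _ ≤ ∑ i ∈ s, μH[1] (f i '' Icc (a i) (b i)) := measure_biUnion_finset_le s _
    _ ≤ ∑ i ∈ s, (K i : ℝ≥0∞) * ENNReal.ofReal (b i - a i) :=
        Finset.sum_le_sum fun i hi => klph_hausdorffMeasure_image_Icc_le (hf i hi)

/-- … hence finite length. [folklore] -/
theorem klph_hausdorffMeasure_lt_top_of_lipschitz_cover {ι : Type*} (s : Finset ι) {S : Set Momentum}
    (f : ι → ℝ → Momentum) (K : ι → ℝ≥0) (a b : ι → ℝ)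
    (hf : ∀ i ∈ s, LipschitzOnWith (K i) (f i) (Icc (a i) (b i)))
    (hcover : S ⊆ ⋃ i ∈ s, f i '' Icc (a i) (b i)) :
    μH[1] S < ⊤ := by
  refine lt_of_le_of_lt (klph_hausdorffMeasure_le_of_lipschitz_cover s f K a b hf hcover) ?_
  exact ENNReal.sum_lt_top.2 fun i _ => ENNReal.mul_lt_top ENNReal.coe_lt_top ENNReal.ofReal_lt_top

end Summit.HubbardSuperconductivity.HubbardSuperconductivity.Theorems

end
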